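import Summits.Ventures.Crystal3D.Theorems.StickyWulffConstantCoaxialWallLawSeamBiFrameRootRow
import HarnessLib

/-!
# The bi-frame root row SPLITS over the two systems: subadditivity of the root statistic, and the factor-2 fallback from lane F's registered inputs
# (lane T, crux `TextureLiminfV5`, stmt-Ventures-23912, registered stub `stub_terraceCensus`; cf-p1 RULINGS (ccxcviii) «F(L₁,L₂) ≤ F(L₁) + F(L₂)» / (ccc)(2)(iii) «generic class»)

HONEST FRAMING. Venture `Summits/Ventures/Crystal3D` (cell `crystal3d-full`), route `route-Ventures-StickyWulffConstant`.  Census-free, certificate-free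
bookkeeping plus ONE conditional packaging; the hypotheses `TailResidue.ThreePayer` and `TailResidue.UnionCoreGradedCapWin₃ s` are lane F's registered NAMED INPUTS
('…SeamThreePayer', '…SeamGradedRow' — lane F registers `s = 2√6`); nothing is proved about them; F-C1 not moved.

THE POINT.  cf-p1 (ccxcviii) designs the certificate for the bi-family row of lane T as «coincidence classes of the relative frame (lane F's word-net cases) ∪ the GENERIC
class, where the two families share no root-end geometry and the load is additive».  This file puts the additive half in the kernel, in the currency of the TRUE root
statistic (`localStatRootA`, '…EndRowRootTransport'):
* `exists_root_coincidence_of_isRootEndPair_both` — a pair `(b, q)` that is a root-class end pair of BOTH systems forces a one-slot coincidence `G₁ r₁ = G₂ r₂` of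
  the two frames (so for frame pairs without such a coincidence the two families' mover sets at every end ball are disjoint);
* `endMultRootA_le_add`, **`localStatRootA_le_add`**: `localStatRootA v S₁ S₂ X z ≤ localStatRootA v S₁ S₁ X z + localStatRootA v S₂ S₂ X z` — ALWAYS (multiplicity of
  a union; the pools `pooledDef X b` are common to both families), no genericity needed for the inequality;
* `localEndRowRootA_of_add : LocalEndRowRootA v s₁ S₁ S₁ → LocalEndRowRootA v s₂ S₂ S₂ → LocalEndRowRootA v (s₁ + s₂) S₁ S₂`;
* `localEndRowA_self_of_pair` (the (A) row of a pair gives the row of either system alone), `localEndRowRootA_basal_self_of_gradedWin₃ (h3) (h) G :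
  LocalEndRowRootA v2 s (basalSystem G) (basalSystem G)` from lane F's inputs (`localSummandA_le_of_threePayer_of_gradedWin₃` at the standard pair `(G, H ≫ G)`);
* **`endRowBiFrameRootA_two_mul_of_threePayer_of_gradedWin₃ : ThreePayer → UnionCoreGradedCapWin₃ s → EndRowBiFrameRootA WordVersion.v2 (2 * s)`** — THE FACTOR-2
  FALLBACK in ROW currency: lane F's registered inputs ALONE give lane T's bi-frame root row at TWICE the line, with no new certificate (the flux-currency form of the same
  fact is '…LevelReachHexagonGradedGlue' `hexagon_twoPlate_flux_le_twice_payerSum_of_gradedWin₃`); the bi-family certificate `BiFrameRootGradedCapWin₃ (9/2)`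
  ('…SeamBiFrameRootRow') is exactly what buys the factor back.
WHAT THIS IS NOT: no census fact, no certificate; the `2 * s` row does NOT close (β) at charge 13/25 (cf-p1 (ccc)(1): margins 2.44/3.07/3.78/1.82 need the factor 1);
F-C1 not moved.
-/

noncomputable section

namespace Summit.Ventures.Crystal3D.Theorems

namespace TailResidue

open Summit.Ventures.Crystal3D Finset
open scoped InnerProductSpace

/-! ### A pair that is a root pair of both systems forces a slot coincidence of the frames -/

/-- **Root pairs of both systems force a one-slot coincidence**: if `(b, q)` is a root-class end pair of `⟨G₁, R₁⟩` and of `⟨G₂, R₂⟩` then `G₁ r₁ = G₂ r₂` for some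
roots `r₁ ∈ R₁`, `r₂ ∈ R₂` (both equal `b − q`). -/
theorem exists_root_coincidence_of_isRootEndPair_both {X : Finset (EuclideanSpace ℝ (Fin 3))} {v : WordVersion}
    {G₁ G₂ : EuclideanSpace ℝ (Fin 3) ≃ₗᵢ[ℝ] EuclideanSpace ℝ (Fin 3)} {R₁ R₂ : Finset (EuclideanSpace ℝ (Fin 3))} {b q : EuclideanSpace ℝ (Fin 3)}
    (h₁ : IsRootEndPair X v ⟨G₁, R₁⟩ b q) (h₂ : IsRootEndPair X v ⟨G₂, R₂⟩ b q) : ∃ r₁ ∈ R₁, ∃ r₂ ∈ R₂, G₁ r₁ = G₂ r₂ := by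
  obtain ⟨r₁, hr₁, e₁⟩ := exists_root_of_isRootEndPair h₁
  obtain ⟨r₂, hr₂, e₂⟩ := exists_root_of_isRootEndPair h₂
  exact ⟨r₁, hr₁, r₂, hr₂, by rw [← e₁, ← e₂]⟩

/-! ### Subadditivity over the two systems -/

/-- For a single system the pair row counts the system's root pairs: `IsEndPairRootA X v S S b q ↔ IsRootEndPair X v S b q`. -/
theorem isEndPairRootA_self_iff {X : Finset (EuclideanSpace ℝ (Fin 3))} {v : WordVersion} {S : PlateSystem} {b q : EuclideanSpace ℝ (Fin 3)} :
    IsEndPairRootA X v S S b q ↔ IsRootEndPair X v S b q :=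
  ⟨fun h => h.elim id id, fun h => Or.inl h⟩

open scoped Classical in
/-- **Root multiplicities are subadditive over the two systems.** -/
theorem endMultRootA_le_add (X : Finset (EuclideanSpace ℝ (Fin 3))) (v : WordVersion) (S₁ S₂ : PlateSystem) (b : EuclideanSpace ℝ (Fin 3)) :
    endMultRootA X v S₁ S₂ b ≤ endMultRootA X v S₁ S₁ b + endMultRootA X v S₂ S₂ b := by
  unfold endMultRootA
  calc (X.filter fun q => IsEndPairRootA X v S₁ S₂ b q).card
      ≤ ((X.filter fun q => IsEndPairRootA X v S₁ S₁ b q) ∪ (X.filter fun q => IsEndPairRootA X v S₂ S₂ b q)).card := by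
        refine card_le_card fun q hq => ?_
        obtain ⟨hqX, hp⟩ := mem_filter.1 hq
        rcases hp with h | h
        · exact mem_union.2 (Or.inl (mem_filter.2 ⟨hqX, Or.inl h⟩))
        · exact mem_union.2 (Or.inr (mem_filter.2 ⟨hqX, Or.inl h⟩))
    _ ≤ _ := card_union_le _ _

open scoped Classical in
/-- One family's load inside the joint statistic is at most that family's own statistic: the joint index set's terms with `endMultRootA X v S S b = 0` vanish and the
rest are terms of the single-system statistic. -/
theorem sum_single_le_localStatRootA (v : WordVersion) (S₁ S₂ S : PlateSystem) (X : Finset (EuclideanSpace ℝ (Fin 3))) (z : EuclideanSpace ℝ (Fin 3)) :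
    ∑ b ∈ X.filter (fun b => dist z b ≤ 1 ∧ 0 < endMultRootA X v S₁ S₂ b), (endMultRootA X v S S b : ℝ) / pooledDef X b ≤ localStatRootA v S S X z := by
  unfold localStatRootA
  have hD : ∀ b, 0 ≤ pooledDef X b := by
    intro b
    refine sum_nonneg fun z' hz' => ?_
    have : ((X.filter fun q => dist z' q = 1).card : ℝ) ≤ 11 := by exact_mod_cast (mem_filter.1 hz').2.2
    linarith
  set f : EuclideanSpace ℝ (Fin 3) → ℝ := fun b => (endMultRootA X v S S b : ℝ) / pooledDef X b with hf
  have hnn : ∀ b, 0 ≤ f b := fun b => div_nonneg (Nat.cast_nonneg _) (hD b)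
  rw [← sum_filter_ne_zero (X.filter fun b => dist z b ≤ 1 ∧ 0 < endMultRootA X v S₁ S₂ b)]
  refine sum_le_sum_of_subset_of_nonneg (fun b hb => ?_) fun b _ _ => hnn b
  rw [mem_filter] at hb
  obtain ⟨hb, hne⟩ := hb
  obtain ⟨hbX, hzb, -⟩ := mem_filter.1 hb
  refine mem_filter.2 ⟨hbX, hzb, Nat.pos_of_ne_zero fun h0 => hne ?_⟩
  show (endMultRootA X v S S b : ℝ) / pooledDef X b = 0
  rw [h0, Nat.cast_zero, zero_div]

open scoped Classical in
/-- **The root statistic is subadditive over the two systems** (common pools): `localStatRootA (S₁, S₂) ≤ localStatRootA (S₁, S₁) + localStatRootA (S₂, S₂)`. -/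
theorem localStatRootA_le_add (v : WordVersion) (S₁ S₂ : PlateSystem) (X : Finset (EuclideanSpace ℝ (Fin 3))) (z : EuclideanSpace ℝ (Fin 3)) :
    localStatRootA v S₁ S₂ X z ≤ localStatRootA v S₁ S₁ X z + localStatRootA v S₂ S₂ X z := by
  have hD : ∀ b, 0 ≤ pooledDef X b := by
    intro b
    refine sum_nonneg fun z' hz' => ?_
    have : ((X.filter fun q => dist z' q = 1).card : ℝ) ≤ 11 := by exact_mod_cast (mem_filter.1 hz').2.2
    linarith
  calc localStatRootA v S₁ S₂ X z
      = ∑ b ∈ X.filter (fun b => dist z b ≤ 1 ∧ 0 < endMultRootA X v S₁ S₂ b), (endMultRootA X v S₁ S₂ b : ℝ) / pooledDef X b := rfl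
    _ ≤ ∑ b ∈ X.filter (fun b => dist z b ≤ 1 ∧ 0 < endMultRootA X v S₁ S₂ b),
          ((endMultRootA X v S₁ S₁ b : ℝ) / pooledDef X b + (endMultRootA X v S₂ S₂ b : ℝ) / pooledDef X b) := by
        refine sum_le_sum fun b _ => ?_
        rw [← add_div]
        exact div_le_div_of_nonneg_right (by exact_mod_cast endMultRootA_le_add X v S₁ S₂ b) (hD b)
    _ = (∑ b ∈ X.filter (fun b => dist z b ≤ 1 ∧ 0 < endMultRootA X v S₁ S₂ b), (endMultRootA X v S₁ S₁ b : ℝ) / pooledDef X b) +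
          ∑ b ∈ X.filter (fun b => dist z b ≤ 1 ∧ 0 < endMultRootA X v S₁ S₂ b), (endMultRootA X v S₂ S₂ b : ℝ) / pooledDef X b := sum_add_distrib
    _ ≤ localStatRootA v S₁ S₁ X z + localStatRootA v S₂ S₂ X z :=
        add_le_add (sum_single_le_localStatRootA v S₁ S₂ S₁ X z) (sum_single_le_localStatRootA v S₁ S₂ S₂ X z)

/-- **Rows add**: single-system root rows at `s₁` and `s₂` give the bi-system root row at `s₁ + s₂`. -/
theorem localEndRowRootA_of_add {v : WordVersion} {s₁ s₂ : ℝ} {S₁ S₂ : PlateSystem} (h₁ : LocalEndRowRootA v s₁ S₁ S₁) (h₂ : LocalEndRowRootA v s₂ S₂ S₂) :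
    LocalEndRowRootA v (s₁ + s₂) S₁ S₂ := by
  rw [localEndRowRootA_iff] at h₁ h₂ ⊢
  intro X hX z hz hdeg
  exact (localStatRootA_le_add v S₁ S₂ X z).trans (add_le_add (h₁ X hX z hz hdeg) (h₂ X hX z hz hdeg))

/-! ### Single-system rows from lane F's registered inputs -/

/-- An (A)-end pair of the system `S` alone is an (A)-end pair of any pair `(S, S')`. -/
theorem isEndPairA_of_self {X : Finset (EuclideanSpace ℝ (Fin 3))} {v : WordVersion} {S : PlateSystem} (S' : PlateSystem) {b q : EuclideanSpace ℝ (Fin 3)}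
    (h : IsEndPairA X v S S b q) : IsEndPairA X v S S' b q := by
  obtain ⟨hq, hb, hpay, G, d, hadm, hqd, hmove⟩ := h
  exact ⟨hq, hb, hpay, G, d, Or.inl (hadm.elim id id), hqd, hmove⟩

open scoped Classical in
/-- The (A) summand of `S` alone is at most the (A) summand of the pair `(S, S')`. -/
theorem localSummandA_self_le (v : WordVersion) (S S' : PlateSystem) (X : Finset (EuclideanSpace ℝ (Fin 3))) (z : EuclideanSpace ℝ (Fin 3)) :
    localSummandA v S S X z ≤ localSummandA v S S' X z := by
  unfold localSummandA
  have hD : ∀ b, 0 ≤ pooledDef X b := by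
    intro b
    refine sum_nonneg fun z' hz' => ?_
    have : ((X.filter fun q => dist z' q = 1).card : ℝ) ≤ 11 := by exact_mod_cast (mem_filter.1 hz').2.2
    linarith
  have hmult : ∀ b, endMultA X v S S b ≤ endMultA X v S S' b := by
    intro b
    unfold endMultA
    exact card_le_card fun q hq => mem_filter.2 ⟨(mem_filter.1 hq).1, isEndPairA_of_self S' (mem_filter.1 hq).2⟩
  calc ∑ b ∈ X.filter (fun b => dist z b ≤ 1 ∧ 0 < endMultA X v S S b), (endMultA X v S S b : ℝ) / pooledDef X b
      ≤ ∑ b ∈ X.filter (fun b => dist z b ≤ 1 ∧ 0 < endMultA X v S S b), (endMultA X v S S' b : ℝ) / pooledDef X b :=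
        sum_le_sum fun b _ => div_le_div_of_nonneg_right (by exact_mod_cast hmult b) (hD b)
    _ ≤ ∑ b ∈ X.filter (fun b => dist z b ≤ 1 ∧ 0 < endMultA X v S S' b), (endMultA X v S S' b : ℝ) / pooledDef X b := by
        refine sum_le_sum_of_subset_of_nonneg (fun b hb => ?_) fun b _ _ => div_nonneg (Nat.cast_nonneg _) (hD b)
        obtain ⟨hbX, hd, hpos⟩ := mem_filter.1 hb
        exact mem_filter.2 ⟨hbX, hd, lt_of_lt_of_le hpos (hmult b)⟩

/-- **The (A) row of a pair gives the row of its first system alone.** -/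
theorem localEndRowA_self_of_pair {v : WordVersion} {sF : ℝ} {S S' : PlateSystem} (h : LocalEndRowA v sF S S') : LocalEndRowA v sF S S :=
  fun X hX z hz hdeg => (localSummandA_self_le v S S' X z).trans (h X hX z hz hdeg)

/-- **Lane F's registered inputs give the single-system ROOT row of every basal system**: `ThreePayer → UnionCoreGradedCapWin₃ s → LocalEndRowRootA v2 s (basalSystem G)
(basalSystem G)` (the standard pair `(G, H ≫ G)` of `localSummandA_le_of_threePayer_of_gradedWin₃`, then the first system alone, then root ≤ (A)). -/
theorem localEndRowRootA_basal_self_of_gradedWin₃ (h3 : ThreePayer) {s : ℝ} (h : UnionCoreGradedCapWin₃ s)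
    (G : EuclideanSpace ℝ (Fin 3) ≃ₗᵢ[ℝ] EuclideanSpace ℝ (Fin 3)) : LocalEndRowRootA WordVersion.v2 s (basalSystem G) (basalSystem G) := by
  have hpair : LocalEndRowA WordVersion.v2 s (basalSystem G) (basalSystem (((ℝ ∙ EuclideanSpace.single (2 : Fin 3) (1 : ℝ)).reflection).trans G)) :=
    fun _ hX _ hz hdeg => localSummandA_le_of_threePayer_of_gradedWin₃ h3 h G hX hz hdeg
  exact localEndRowRootA_of_localEndRowA (localEndRowA_self_of_pair hpair)

/-- **THE FACTOR-2 FALLBACK (row currency)**: lane F's registered inputs ALONE give lane T's bi-frame root row at TWICE the line —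
`ThreePayer → UnionCoreGradedCapWin₃ s → EndRowBiFrameRootA v2 (2 * s)` — with no bi-family certificate. -/
theorem endRowBiFrameRootA_two_mul_of_threePayer_of_gradedWin₃ (h3 : ThreePayer) {s : ℝ} (h : UnionCoreGradedCapWin₃ s) :
    EndRowBiFrameRootA WordVersion.v2 (2 * s) := by
  intro G₁ G₂
  rw [two_mul]
  exact localEndRowRootA_of_roots (inPlaneRoots_subset_basalHexagon G₁ 1) (inPlaneRoots_subset_basalHexagon G₂ (-1))
    (localEndRowRootA_of_add (localEndRowRootA_basal_self_of_gradedWin₃ h3 h G₁) (localEndRowRootA_basal_self_of_gradedWin₃ h3 h G₂))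

/-- The instance behind lane T's numerals: lane F's `9/2` line (the stronger instance lane T already needs, `unionCoreGradedCapWin₃_mono`) gives the bi-frame root row at
`9` for free; the registered `2√6` line gives it at `4√6`. -/
theorem endRowBiFrameRootA_nine_of_threePayer_of_gradedWin₃ (h3 : ThreePayer) (h : UnionCoreGradedCapWin₃ (9 / 2)) : EndRowBiFrameRootA WordVersion.v2 9 := by
  have e : (9 : ℝ) = 2 * (9 / 2) := by norm_num
  rw [e]; exact endRowBiFrameRootA_two_mul_of_threePayer_of_gradedWin₃ h3 h

end TailResidue

end Summit.Ventures.Crystal3D.Theorems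

end
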